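import Summits.PneNP.PneNP.Theorems.ChebyshevTracialDesignJuntaTimesSquare
import Summits.PneNP.PneNP.Theorems.ChebyshevTracialDesignAmplitudeOneReduction
import HarnessLib

/-!
# Cell pnp-psdrank, route `ChebyshevTracialDesign`: LOW-DEGREE GRAM FACTORS WITH JUNTA AMPLITUDES, EVERY DIMENSION — `X_U = f(U)·B_UB_Uᵀ` with `f` a
# nonnegative `J`-junta and `B_U` of Johnson degree `≤ d` (coefficient energy `E_α`) against any psd contraction field `Y`:
# `Σ W f tr(B_UB_UᵀY_M) ≤ B_v·C(T,D+1)·#{|A'|≤d}·E_α·Λ_f·4^k·C(k,D+1)(D+1)!N^{k−D−1}/[N]_k`, `k = |J|+2d` (crux `TracialDecayExp20`, stmt-PneNP-19878)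

Brick 116 (prover g20; MEMO-23 §2(f); the degree-`d` companion of brick 115). The SIGN cell (bricks 23/89/94b) prices `X_U = A_UA_Uᵀ` with `A` of low
Johnson degree; a high-degree {0,1} AMPLITUDE destroys the Gram degree (barrier 4, MEMO-21 §1), and MEMO-21's amplitude classes `𝒜_d` (`f(U)·B_UB_Uᵀ`,
`B` of degree `d`) were reached only CONDITIONALLY (CG_d ⟹ 𝒜_d, bricks 106/108 for `d = 1`). With brick 114 (junta × degree-`d` square) the junta-amplitude
part of every `𝒜_d` is priced outright:
* §1 `dotProduct_mulVec_eq_sum_sq` (`xᵀYx = Σ_l(Sx)_l²` for `Y = SᵀS`), **`sum_sq_gram_le`** (`I − Y ⪰ 0` ⇒ `Σ_l(Sx)_l² ≤ Σ x²`: a Gram root of a psd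
  contraction is a contraction).
* §2 **`value_juntaAmplitude_lowDegree_le`** — exact design `(n,t,T,D,B_v,C,w)`; `f ≥ 0` a `J`-junta `≤ Λ_f`; `B_U(b,j) = Σ_{|A'|≤d} α_{bjA'}1[A' ⊆ U]`
  (`r × m`, any `r, m`), `k = |J|+2d`, `2k+1 ≤ t`; `0 ⪯ Y_M ⪯ I`:
  `Σ_UΣ_M W(U,M)·f(U)·tr(B_UB_UᵀY_M) ≤ B_v·C(T,D+1)·(#{A' : |A'| ≤ d}·Σ_{b,j,A'}α_{bjA'}²)·Λ_f·4^k·C(k,D+1)(D+1)!·N^{k−D−1}/[N]_k`.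
  Per matching `Y_M = SᵀS` (`exists_gram_of_posSemidef`), `f·tr(B_UB_UᵀY_M) = Σ_{l,j} f·((SB_U)_{lj})²` (brick 106 `trace_mul_transpose_mul_gram`), each
  `(SB_U)_{lj}` a degree-`d` combination with coefficients `γ = Sα`: brick 114 per `(l,j)`, `(Σ|γ|)² ≤ #A'·Σγ²` (Cauchy–Schwarz) and `Σ_lγ_{ljA'}² ≤ Σ_bα_{bjA'}²` (§1).
READING: no contraction hypothesis on `B` is needed — the coefficient energy `E_α` is the parameter (for `d = 1`, homogeneous `B_U = Σ_px_pβ_p ⪯`-contraction,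
brick 108 gives `E_α ≤ r·n(n−1)/(t(n−t))`, recovering brick 115 up to the factor `#A' = n+1`); in the balanced Chebyshev regime the bound is
`E_α·poly(n)·n^{−(dq n+1)/4+O(k/ln n)}`: junta amplitudes of size `O(dq n)` on Gram factors of degree `O(dq n)` are priced at every dimension.
[cite: GriblingDelaatLaurent2019, §5] [cite: Rothvoss2017, §2 (PDF p. 6)] [cite: Grigoriev2001, Lemma 1.4 (PDF p. 8)] [cite: LeeRaghavendraSteurer2015, §5]
[cite: Agarwal2000DifferenceEquations, Remark 1.8.1 (1.8.8)]
Stature: support/instrument (kernel lane, no defs, axioms standard). WHAT THIS IS NOT: nothing on non-junta amplitudes (the open structure step N2),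
no proof or refutation of `TracialDecayExp20`, nothing on psd rank of P_PM(K_n), no P-vs-NP content. Supports stmt-PneNP-19878.
-/

set_option linter.dupNamespace false -- `Summit.PneNP.PneNP.…`: summit = sub-problem (D-0017)

noncomputable section

namespace Summit.PneNP.PneNP.Theorems.ChebyshevTracialDesignJuntaAmplitudeLowDegree

open Finset Matrix Polynomial Literature.Barriers.PneNP Literature.Combinatorics.Optimization
open Summit.PneNP.PneNP.Theorems.ChebyshevTracialDesignJuntaTimesSquare (juntaTimesSquare_le_single)
open Summit.PneNP.PneNP.Theorems.ChebyshevTracialDesignJunta (exists_gram_of_posSemidef)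
open Summit.PneNP.PneNP.Theorems.ChebyshevTracialDesignAmplitudeOneReduction (trace_mul_transpose_mul_gram)

variable {n : ℕ}

/-! ### §1 Linear algebra: a Gram root of a contraction is a contraction -/

/-- For real `Y = SᵀS` (entrywise `Y b a = Σ_l S l a · S l b`): `x ⬝ (Y x) = Σ_l (Σ_a S l a x a)²`. [folklore] -/
theorem dotProduct_mulVec_eq_sum_sq {r : ℕ} {Y S : Matrix (Fin r) (Fin r) ℝ} (hS : ∀ a b, Y b a = ∑ l, S l a * S l b) (x : Fin r → ℝ) :
    x ⬝ᵥ (Y *ᵥ x) = ∑ l, (∑ a, S l a * x a) ^ 2 := by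
  have e1 : x ⬝ᵥ (Y *ᵥ x) = ∑ b, ∑ a, ∑ l, x b * (S l a * S l b * x a) := by
    simp only [dotProduct, mulVec, hS, sum_mul, mul_sum]
  have e2 : ∑ l, (∑ a, S l a * x a) ^ 2 = ∑ l, ∑ a, ∑ b, (S l a * x a) * (S l b * x b) := by
    refine sum_congr rfl fun l _ => ?_
    rw [sq, sum_mul_sum]
  rw [e1, e2]
  calc ∑ b, ∑ a, ∑ l, x b * (S l a * S l b * x a)
      = ∑ b, ∑ l, ∑ a, x b * (S l a * S l b * x a) := sum_congr rfl fun b _ => sum_comm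
    _ = ∑ l, ∑ b, ∑ a, x b * (S l a * S l b * x a) := sum_comm
    _ = ∑ l, ∑ a, ∑ b, (S l a * x a) * (S l b * x b) := sum_congr rfl fun l _ => by
        rw [sum_comm]; exact sum_congr rfl fun a _ => sum_congr rfl fun b _ => by ring

/-- **A Gram root of a psd contraction is a contraction**: if `Y = SᵀS` and `I − Y ⪰ 0` then `Σ_l (Σ_a S l a x a)² ≤ Σ_a x_a²`. [folklore] -/
theorem sum_sq_gram_le {r : ℕ} {Y S : Matrix (Fin r) (Fin r) ℝ} (hS : ∀ a b, Y b a = ∑ l, S l a * S l b) (h1Y : (1 - Y).PosSemidef)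
    (x : Fin r → ℝ) : ∑ l, (∑ a, S l a * x a) ^ 2 ≤ ∑ a, x a ^ 2 := by
  have h := h1Y.dotProduct_mulVec_nonneg x
  rw [star_trivial, sub_mulVec, dotProduct_sub, one_mulVec, dotProduct_mulVec_eq_sum_sq hS] at h
  have hx : x ⬝ᵥ x = ∑ a, x a ^ 2 := by simp only [dotProduct, sq]
  linarith

/-! ### §2 Low-degree Gram factors with junta amplitudes, every dimension -/

/-- **LOW-DEGREE GRAM FACTORS WITH JUNTA AMPLITUDES ARE PRICED AT EVERY DIMENSION.** For an exact design `(n,t,T,D,B_v,C,w)`, a nonnegative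
`J`-junta mask `f ≤ Λ_f`, a cut factor `B_U(b,j) = Σ_{|A'|≤d} α_{bjA'}·1[A' ⊆ U]` of Johnson degree `≤ d` (`B_U ∈ ℝ^{r×m}`, ANY `r, m`; coefficient energy
`E_α = Σ_{b,j,A'} α_{bjA'}²`) with `k = |J| + 2d`, `2k+1 ≤ t`, and ANY psd CONTRACTION field `Y` on the matchings (`0 ⪯ Y_M ⪯ I`):
`Σ_UΣ_M W(U,M)·f(U)·tr(B_UB_UᵀY_M) ≤ B_v·C(T,D+1)·(#{A' : |A'| ≤ d}·E_α)·Λ_f·4^k·C(k,D+1)(D+1)!·N^{k−D−1}/[N]_k` (`N = n/2`).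
MECHANISM: per matching `Y_M = SᵀS`, `tr(B_UB_UᵀY_M) = Σ_{l,j}((SB_U)_{lj})²` (brick 106's SOS step) and each `(SB_U)_{lj}` is a degree-`d` combination with
coefficients `γ = Sα`; brick 114 prices `f·(SB_U)_{lj}²` with `(Σ|γ|)² ≤ #A'·Σγ²`, and `Σ_lγ² ≤ Σ_bα²` because `S` is a contraction (`I − SᵀS ⪰ 0`).
For `d = 1`, homogeneous `B_U = Σ_px_pβ_p` and `B_UB_Uᵀ ⪯ I`, brick 108 bounds `E_α = Σ_p‖β_p‖_F² ≤ r·n(n−1)/(t(n−t))` — brick 115's 𝒜₁ statement.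
[cite: GriblingDelaatLaurent2019, §5] [cite: Rothvoss2017, §2 (PDF p. 6)] [cite: Grigoriev2001, Lemma 1.4 (PDF p. 8)] [cite: LeeRaghavendraSteurer2015, §5] -/
theorem value_juntaAmplitude_lowDegree_le {t T D : ℕ} {Bv : ℝ} {C : Finset ℕ} {w : ℕ → ℝ} (hdes : IsExactDesign n t T D Bv C w)
    (J : Finset (Fin n)) {d : ℕ} (hJt : 2 * (J.card + 2 * d) + 1 ≤ t)
    (f : OddSet n → ℝ) (hf : ∀ U U' : OddSet n, U.1 ∩ J = U'.1 ∩ J → f U = f U') {Λf : ℝ} (hf0 : ∀ U, 0 ≤ f U) (hfΛ : ∀ U, f U ≤ Λf)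
    {r m : ℕ} (α : Fin r → Fin m → {A' : Finset (Fin n) // A'.card ≤ d} → ℝ)
    (Y : PMatch n → Matrix (Fin r) (Fin r) ℝ) (hY : ∀ M, (Y M).PosSemidef ∧ (1 - Y M).PosSemidef) :
    ∑ U : OddSet n, ∑ M : PMatch n, levelWeight n t C w U M *
        (f U * ((Matrix.of fun b j => ∑ A' : {A' : Finset (Fin n) // A'.card ≤ d}, α b j A' * (if A'.1 ⊆ U.1 then (1 : ℝ) else 0)) *
          (Matrix.of fun b j => ∑ A' : {A' : Finset (Fin n) // A'.card ≤ d}, α b j A' * (if A'.1 ⊆ U.1 then (1 : ℝ) else 0))ᵀ * Y M).trace) ≤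
      Bv * ((T.choose (D + 1) : ℕ) : ℝ) *
        (((Fintype.card {A' : Finset (Fin n) // A'.card ≤ d} : ℝ) * ∑ b, ∑ j, ∑ A', α b j A' ^ 2) * Λf * (4 : ℝ) ^ (J.card + 2 * d) *
        ((((J.card + 2 * d).choose (D + 1) : ℕ) : ℝ) * ((D + 1).factorial : ℝ) * (((n / 2 : ℕ) : ℝ)) ^ (J.card + 2 * d - (D + 1)) /
          ((n / 2).descFactorial (J.card + 2 * d) : ℝ))) := by
  classical
  have htn : 2 * t + 2 ≤ n := hdes.2.1
  have hB0 : 0 ≤ Bv := (sum_nonneg fun c _ => abs_nonneg (w c)).trans hdes.2.2.2.2.2.2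
  have hΛf : 0 ≤ Λf := by
    have hodd1 : Odd (({(⟨0, by omega⟩ : Fin n)} : Finset (Fin n)).card) := by simp
    exact (hf0 ⟨_, hodd1⟩).trans (hfΛ ⟨_, hodd1⟩)
  set k := J.card + 2 * d with hk
  set R : ℝ := Λf * (4 : ℝ) ^ k * (((k.choose (D + 1) : ℕ) : ℝ) * ((D + 1).factorial : ℝ) * (((n / 2 : ℕ) : ℝ)) ^ (k - (D + 1)) /
    ((n / 2).descFactorial k : ℝ)) with hR
  have hR0 : 0 ≤ R := by rw [hR]; positivity
  set Eα : ℝ := ∑ b, ∑ j, ∑ A', α b j A' ^ 2 with hEα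
  set NA : ℝ := (Fintype.card {A' : Finset (Fin n) // A'.card ≤ d} : ℝ) with hNA
  set Bf : OddSet n → Matrix (Fin r) (Fin m) ℝ := fun U =>
    Matrix.of fun b j => ∑ A' : {A' : Finset (Fin n) // A'.card ≤ d}, α b j A' * (if A'.1 ⊆ U.1 then (1 : ℝ) else 0) with hBf
  rw [sum_comm]
  -- per matching
  have hper : ∀ M : PMatch n, ∑ U : OddSet n, levelWeight n t C w U M * (f U * (Bf U * (Bf U)ᵀ * Y M).trace) ≤
      (Fintype.card (PMatch n) : ℝ)⁻¹ * (Bv * ((T.choose (D + 1) : ℕ) : ℝ) * ((NA * Eα) * R)) := by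
    intro M
    obtain ⟨S, hS⟩ := exists_gram_of_posSemidef (hY M).1
    have hYS : Y M = Sᵀ * S := by
      ext b a
      rw [hS a b, Matrix.mul_apply]
      exact sum_congr rfl fun l _ => by rw [Matrix.transpose_apply]; ring
    -- the coefficients of `S·B_U`
    set γ : Fin r → Fin m → {A' : Finset (Fin n) // A'.card ≤ d} → ℝ := fun l j A' => ∑ b, S l b * α b j A' with hγ
    have hSB : ∀ (U : OddSet n) l j, (S * Bf U) l j = ∑ A' : {A' : Finset (Fin n) // A'.card ≤ d}, γ l j A' * (if A'.1 ⊆ U.1 then (1 : ℝ) else 0) := by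
      intro U l j
      rw [Matrix.mul_apply]
      simp only [hBf, hγ, Matrix.of_apply, mul_sum, sum_mul]
      exact sum_comm.trans (sum_congr rfl fun A' _ => sum_congr rfl fun b _ => by ring)
    -- value at `M` as a sum of `r·m` scalar tilted-junta forms
    have hval : ∀ U : OddSet n, f U * (Bf U * (Bf U)ᵀ * Y M).trace =
        ∑ l, ∑ j, f U * (∑ A' : {A' : Finset (Fin n) // A'.card ≤ d}, γ l j A' * (if A'.1 ⊆ U.1 then (1 : ℝ) else 0)) ^ 2 := by
      intro U
      rw [hYS, trace_mul_transpose_mul_gram, mul_sum]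
      refine sum_congr rfl fun l _ => ?_
      rw [mul_sum]
      exact sum_congr rfl fun j _ => by rw [hSB U l j]
    have hlhs : ∑ U : OddSet n, levelWeight n t C w U M * (f U * (Bf U * (Bf U)ᵀ * Y M).trace) =
        ∑ l, ∑ j, ∑ U : OddSet n, levelWeight n t C w U M *
          (f U * (∑ A' : {A' : Finset (Fin n) // A'.card ≤ d}, γ l j A' * (if A'.1 ⊆ U.1 then (1 : ℝ) else 0)) ^ 2) := by
      calc ∑ U : OddSet n, levelWeight n t C w U M * (f U * (Bf U * (Bf U)ᵀ * Y M).trace)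
          = ∑ U : OddSet n, ∑ l, ∑ j, levelWeight n t C w U M *
              (f U * (∑ A' : {A' : Finset (Fin n) // A'.card ≤ d}, γ l j A' * (if A'.1 ⊆ U.1 then (1 : ℝ) else 0)) ^ 2) := by
            refine sum_congr rfl fun U _ => ?_
            rw [hval U, mul_sum]
            exact sum_congr rfl fun l _ => by rw [mul_sum]
        _ = _ := by rw [sum_comm]; exact sum_congr rfl fun l _ => sum_comm
    rw [hlhs]
    -- each scalar form by brick 114
    have hterm : ∀ l j, ∑ U : OddSet n, levelWeight n t C w U M *
        (f U * (∑ A' : {A' : Finset (Fin n) // A'.card ≤ d}, γ l j A' * (if A'.1 ⊆ U.1 then (1 : ℝ) else 0)) ^ 2) ≤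
        (Fintype.card (PMatch n) : ℝ)⁻¹ * (Bv * ((T.choose (D + 1) : ℕ) : ℝ) * ((∑ A', |γ l j A'|) ^ 2 * R)) := by
      intro l j
      have h := juntaTimesSquare_le_single hdes M J hJt f hf hf0 hfΛ (γ l j)
      refine h.trans (le_of_eq ?_)
      rw [hR]; ring
    refine (sum_le_sum fun l _ => sum_le_sum fun j _ => hterm l j).trans ?_
    -- the coefficient masses: `(Σ|γ|)² ≤ #A'·Σγ²` and `Σ_l γ² ≤ Σ_b α²` (contraction)
    have hmass : ∑ l, ∑ j, (∑ A', |γ l j A'|) ^ 2 ≤ NA * Eα := by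
      calc ∑ l, ∑ j, (∑ A', |γ l j A'|) ^ 2
          ≤ ∑ l, ∑ j, (NA * ∑ A', γ l j A' ^ 2) := sum_le_sum fun l _ => sum_le_sum fun j _ => by
            have h := sq_sum_le_card_mul_sum_sq (s := (univ : Finset {A' : Finset (Fin n) // A'.card ≤ d})) (f := fun A' => |γ l j A'|)
            simp only [card_univ, sq_abs] at h
            rw [hNA]; exact h
        _ = NA * ∑ j, ∑ A', ∑ l, γ l j A' ^ 2 := by
            rw [sum_comm, mul_sum]
            refine sum_congr rfl fun j _ => ?_
            rw [← mul_sum, sum_comm]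
        _ ≤ NA * ∑ j, ∑ A', ∑ b, α b j A' ^ 2 := by
            refine mul_le_mul_of_nonneg_left (sum_le_sum fun j _ => sum_le_sum fun A' _ => ?_) (by rw [hNA]; positivity)
            have h := sum_sq_gram_le hS (hY M).2 (fun b => α b j A')
            simpa [hγ] using h
        _ = NA * Eα := by
            rw [hEα]
            congr 1
            calc ∑ j, ∑ A', ∑ b, α b j A' ^ 2 = ∑ j, ∑ b, ∑ A', α b j A' ^ 2 := sum_congr rfl fun j _ => sum_comm
              _ = ∑ b, ∑ j, ∑ A', α b j A' ^ 2 := sum_comm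
    have h2 : ∑ l, ∑ j, (Fintype.card (PMatch n) : ℝ)⁻¹ * (Bv * ((T.choose (D + 1) : ℕ) : ℝ) * ((∑ A', |γ l j A'|) ^ 2 * R)) =
        (Fintype.card (PMatch n) : ℝ)⁻¹ * (Bv * ((T.choose (D + 1) : ℕ) : ℝ) * R) * ∑ l, ∑ j, (∑ A', |γ l j A'|) ^ 2 := by
      rw [mul_sum]
      refine sum_congr rfl fun l _ => ?_
      rw [mul_sum]
      exact sum_congr rfl fun j _ => by ring
    rw [h2]
    calc (Fintype.card (PMatch n) : ℝ)⁻¹ * (Bv * ((T.choose (D + 1) : ℕ) : ℝ) * R) * ∑ l, ∑ j, (∑ A', |γ l j A'|) ^ 2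
        ≤ (Fintype.card (PMatch n) : ℝ)⁻¹ * (Bv * ((T.choose (D + 1) : ℕ) : ℝ) * R) * (NA * Eα) :=
          mul_le_mul_of_nonneg_left hmass (by positivity)
      _ = _ := by ring
  refine (sum_le_sum fun M _ => hper M).trans ?_
  rw [sum_const, card_univ, nsmul_eq_mul]
  rcases eq_or_ne (Fintype.card (PMatch n) : ℝ) 0 with h0 | h0
  · rw [h0]; simp only [zero_mul]
    have : 0 ≤ NA * Eα := by rw [hNA, hEα]; positivity
    rw [hR] at hR0
    positivity
  · rw [← mul_assoc, mul_inv_cancel₀ h0, one_mul, hR]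
    apply le_of_eq; ring

end Summit.PneNP.PneNP.Theorems.ChebyshevTracialDesignJuntaAmplitudeLowDegree
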